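import Summits.HodgeConjecture.HodgeConjecture.Theses.BoundaryReadout
import Summits.HodgeConjecture.HodgeConjecture.Theorems.BoundaryReadoutBoundarySupplyZeroFloor
import Summits.HodgeConjecture.HodgeConjecture.Theorems.BoundaryReadoutAbsoluteReductionStubAbsoluteOfIso
import Summits.HodgeConjecture.HodgeConjecture.Theorems.PadicSemiregularLiftHodgeBeyondAnchorsProductDescent
import Literature.AlgebraicGeometry.HodgeTheory.HodgeTypeExteriorProduct

/-!
# `BoundaryAbsoluteness` (stmt-HodgeConjecture-15913) · Negative · load-bearing hypotheses

Negative knowledge for the crux `BoundaryReadout.BoundaryAbsoluteness` (route `BoundaryReadout`,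
rank 3; for `f : 𝒳 ⟶ C` onto a smooth projective curve and a global rational `(p,p)` class `ξ`,
absoluteness of `ξ` on finitely many smooth projective pieces `Y_i` COVERING one fibre `X_o`
propagates to `ξ|_{X_t}` on every smooth projective fibre), from the standing disprover's work file
`Cruxes/BoundaryAbsoluteness/Disproof.lean` (refuter-cdisprove-stmt-HodgeConjecture-15913-0, cycle 1,
2026-08-17). Companion of `Negative/HCSafety` (Conj. 11.2.17 ⟹ crux, boundary hypotheses unused).
All statements are spelled out (no definition is declared); all proofs are sorry-free.

* `boundaryAbsoluteness_without_cover_iff`, `boundaryAbsoluteness_without_pieceAbsoluteness_iff`,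
  `boundaryAbsoluteness_without_surjective_iff`: deleting ANY ONE of the three boundary hypotheses
  — the pieces cover `X_o` (`hcov`), the class is absolute Hodge on the pieces (`habs`), `f` is
  surjective (`hf`) — turns the crux into a statement EQUIVALENT to Charles–Schnell Conj. 11.2.17
  on the tree's carriers ("every rational `(p,p)` class on a smooth projective complex variety is
  absolute Hodge"). Witnesses: the constant family `X × ℙ¹ ⟶ ℙ¹` with no piece / with the piece
  `X ≅ X_t` itself (`exists_constFamily`), and the CONSTANT map `X ⟶ ℙ¹` whose fibre over a second
  point is empty and whose fibre over its value is `X` (`exists_iso_fiberOver_const`,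
  `isEmpty_fiberOver_const`); absoluteness is carried back along `X ≅ X_t` by `stub_absoluteOfIso`.
  So these hypotheses are load-bearing exactly to the extent that Conj. 11.2.17 is open, and no
  `_false_without_` theorem for them exists short of `¬` Conj. 11.2.17 (hence `¬HC`, `HCSafety`).
* `boundaryAbsoluteness_false_without_fibreHyp`: deleting the conclusion's fibre hypothesis
  `IsSmoothProjective n (fiberOver f t)` makes the crux FALSE, by a witness all of whose hypotheses
  the tree discharges today: the constant family of the POINT `pt × ℙ¹ ⟶ ℙ¹`, `p = 1`, one piece
  `Y = pt` glued onto `X_t ≅ pt` (it covers), absolute Hodge on the piece by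
  `isAbsoluteHodgeClass_unit`; the deleted clause at `n = 1` would give a `HodgeModel 1` of the
  one-point scheme `X_t`, i.e. a complex curve homeomorphic to a point
  (`false_of_hodgeModel_of_subsingleton`). In `ht` only smoothness and "`n` = fibre dimension" are
  visibly load-bearing; projectivity of `X_t` is automatic and its geometric irreducibility is
  possibly unnecessary (information for the planner, not a defect of the crux).

References: Charles–Schnell 2014, Def. 11.2.3, §11.2.5 Conj. 11.2.17; Hartshorne II.3 (fibres).
-/

-- the mandated namespace repeats `HodgeConjecture` (single-conjunct summit)
set_option linter.dupNamespace false

noncomputable section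

namespace Summit.HodgeConjecture.HodgeConjecture.Theorems.BoundaryAbsoluteness.Negative.LoadBearing

open CategoryTheory CategoryTheory.Limits AlgebraicGeometry MonoidalCategory CartesianMonoidalCategory
open Literature.AlgebraicTopology.SingularHomology
open Literature.AlgebraicGeometry Literature.AlgebraicGeometry.Motives
  Literature.AlgebraicGeometry.HodgeTheory
open Summit.HodgeConjecture.HodgeConjecture.Theorems

/-! ### `hcov` and `habs`: without either, the crux is Conj. 11.2.17 -/

/-- **Without the covering hypothesis `hcov` the crux is equivalent to Conj. 11.2.17.** (→) the
constant family `X × ℙ¹ ⟶ ℙ¹` (`exists_constFamily`) with NO pieces (`ι = PEmpty`): absoluteness of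
`ξ|_{X_t}` is transported back to `X` along the slice isomorphism (`stub_absoluteOfIso`); (←) the
conclusion is an instance of 11.2.17 (`IsRationalClass.pullback`, `IsOfHodgeType.map_of_isSmoothProjective`).
[cite: CharlesSchnell2014Notes, §11.2.5 Conj. 11.2.17] -/
theorem boundaryAbsoluteness_without_cover_iff :
    (∀ (N p : ℕ) (𝒳 C : SchemeOver ℂ) (f : 𝒳 ⟶ C) (o : AlgPoints C ℂ),
        IsSmoothProjective N 𝒳 → IsSmoothProjective 1 C → Function.Surjective f.left.base →
        ∀ (ι : Type) [Finite ι] (m : ι → ℕ) (Y : ι → SchemeOver ℂ) (g : ∀ i, Y i ⟶ fiberOver f o),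
          (∀ i, IsSmoothProjective (m i) (Y i)) →
          ∀ ξ : complexBetti 𝒳 (2 * p), IsRationalClass ξ → IsOfHodgeType N 𝒳 (2 * p) p p ξ →
            (∀ i, IsAbsoluteHodgeClass (m i) (Y i) p
              (complexBetti.map (g i ≫ fiberι f o) (2 * p) ξ)) →
            ∀ (t : AlgPoints C ℂ) (n : ℕ), IsSmoothProjective n (fiberOver f t) →
              IsAbsoluteHodgeClass n (fiberOver f t) p (complexBetti.map (fiberι f t) (2 * p) ξ)) ↔
      (∀ ⦃n : ℕ⦄ ⦃X : SchemeOver ℂ⦄, IsSmoothProjective n X →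
        ∀ (p : ℕ) (c : complexBetti X (2 * p)), IsRationalClass c →
          IsOfHodgeType n X (2 * p) p p c → IsAbsoluteHodgeClass n X p c) := by
  constructor
  · intro h n X hX p c hc hpp
    obtain ⟨𝒳, C, f, t, ξ, e, h𝒳, hC, hf, hξr, hξh, ht, -, hslice⟩ := exists_constFamily hX p c
    have key := h (n + 1) p 𝒳 C f t h𝒳 hC hf PEmpty (fun i => i.elim) (fun i => i.elim)
      (fun i => i.elim) (fun i => i.elim) ξ (hξr hc) (hξh hpp) (fun i => i.elim) t n ht
    have hback := stub_absoluteOfIso e ht hX p _ key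
    have hs := hslice (𝟙 X)
    rw [Category.id_comp, complexBetti.map_id, complexBetti_map_comp_apply] at hs
    rwa [hs] at hback
  · intro hHA N p 𝒳 C f o h𝒳 _ _ ι _ m Y g _ ξ hξr hξh _ t n ht
    exact hHA ht p _ (hξr.pullback (AlgPoints.mapContinuous (L := ℂ) (fiberι f t)))
      (hξh.map_of_isSmoothProjective ht h𝒳 (fiberι f t))

/-- **Without absoluteness on the pieces (`habs`) the crux is equivalent to Conj. 11.2.17**
(constant family, one piece `Y = X` glued onto `X_o = X_t` by the slice isomorphism, which covers).
[cite: CharlesSchnell2014Notes, §11.2.5 Conj. 11.2.17] -/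
theorem boundaryAbsoluteness_without_pieceAbsoluteness_iff :
    (∀ (N p : ℕ) (𝒳 C : SchemeOver ℂ) (f : 𝒳 ⟶ C) (o : AlgPoints C ℂ),
        IsSmoothProjective N 𝒳 → IsSmoothProjective 1 C → Function.Surjective f.left.base →
        ∀ (ι : Type) [Finite ι] (m : ι → ℕ) (Y : ι → SchemeOver ℂ) (g : ∀ i, Y i ⟶ fiberOver f o),
          (∀ i, IsSmoothProjective (m i) (Y i)) →
          (∀ x : ↥(fiberOver f o).left, ∃ (i : ι) (y : ↥(Y i).left), (g i).left.base y = x) →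
          ∀ ξ : complexBetti 𝒳 (2 * p), IsRationalClass ξ → IsOfHodgeType N 𝒳 (2 * p) p p ξ →
            ∀ (t : AlgPoints C ℂ) (n : ℕ), IsSmoothProjective n (fiberOver f t) →
              IsAbsoluteHodgeClass n (fiberOver f t) p (complexBetti.map (fiberι f t) (2 * p) ξ)) ↔
      (∀ ⦃n : ℕ⦄ ⦃X : SchemeOver ℂ⦄, IsSmoothProjective n X →
        ∀ (p : ℕ) (c : complexBetti X (2 * p)), IsRationalClass c →
          IsOfHodgeType n X (2 * p) p p c → IsAbsoluteHodgeClass n X p c) := by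
  constructor
  · intro h n X hX p c hc hpp
    obtain ⟨𝒳, C, f, t, ξ, e, h𝒳, hC, hf, hξr, hξh, ht, hcov, hslice⟩ := exists_constFamily hX p c
    have key := h (n + 1) p 𝒳 C f t h𝒳 hC hf Unit (fun _ => n) (fun _ => X) (fun _ => e.hom)
      (fun _ => hX) (fun x => ?_) ξ (hξr hc) (hξh hpp) t n ht
    · have hback := stub_absoluteOfIso e ht hX p _ key
      have hs := hslice (𝟙 X)
      rw [Category.id_comp, complexBetti.map_id, complexBetti_map_comp_apply] at hs
      rwa [hs] at hback
    · obtain ⟨y, hy⟩ := hcov x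
      exact ⟨(), y, hy⟩
  · intro hHA N p 𝒳 C f o h𝒳 _ _ ι _ m Y g _ _ ξ hξr hξh t n ht
    exact hHA ht p _ (hξr.pullback (AlgPoints.mapContinuous (L := ℂ) (fiberι f t)))
      (hξh.map_of_isSmoothProjective ht h𝒳 (fiberι f t))

/-! ### `hf`: constant maps; without surjectivity the crux is Conj. 11.2.17 -/

section ConstantMap

variable {X C : SchemeOver ℂ}

/-- The underlying point of a complex point is the image of ANY point of `Spec ℂ`. [folklore] -/
theorem pt_eq_base (t : AlgPoints C ℂ) (x : ↥(Spec (CommRingCat.of ℂ))) : t.pt = t.left.base x := by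
  have hx : x = (IsLocalRing.closedPoint ℂ : ↥(Spec (CommRingCat.of ℂ))) := Subsingleton.elim _ _
  subst hx
  rfl

/-- A complex point of a `ℂ`-scheme is a monomorphism of schemes (it is a section of the structure
morphism over `Spec ℂ ⟶ Spec ℂ`, an isomorphism). [folklore] -/
theorem mono_left (t : AlgPoints C ℂ) : Mono t.left := by
  haveI : IsIso (CommRingCat.ofHom (algebraMap ℂ ℂ)) := by
    rw [Algebra.algebraMap_self, CommRingCat.ofHom_id]
    infer_instance
  haveI : Mono (specOver ℂ ℂ).hom :=
    show Mono (Spec.map (CommRingCat.ofHom (algebraMap ℂ ℂ))) from inferInstance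
  exact mono_of_mono_fac (Over.w t)

/-- **The fibre of the constant map `X ⟶ Spec ℂ ⟶ C` at `t` over `t` is `X`**, compatibly with the
fibre inclusion (`t` is a monomorphism, so `(𝟙_X, X ⟶ Spec ℂ)` is the fibre product).
[cite: Hartshorne1977, II.3 (fibre of a morphism)] -/
theorem exists_iso_fiberOver_const (X : SchemeOver ℂ) (t : AlgPoints C ℂ) :
    ∃ e : X ≅ fiberOver (toUnit X ≫ (AffineLineProduct.specOverSelfIso ℂ).inv ≫ t) t,
      e.hom ≫ fiberι (toUnit X ≫ (AffineLineProduct.specOverSelfIso ℂ).inv ≫ t) t = 𝟙 X := by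
  haveI := mono_left t
  set s : X.left ⟶ (specOver ℂ ℂ).left := (toUnit X ≫ (AffineLineProduct.specOverSelfIso ℂ).inv).left
  have hfac : (toUnit X ≫ (AffineLineProduct.specOverSelfIso ℂ).inv ≫ t).left = s ≫ t.left := by
    simp only [s, Over.comp_left, Category.assoc]
  have hpb : IsPullback (𝟙 X.left) s (toUnit X ≫ (AffineLineProduct.specOverSelfIso ℂ).inv ≫ t).left t.left := by
    refine IsPullback.of_isLimit' ⟨by rw [hfac, Category.id_comp]⟩ (PullbackCone.IsLimit.mk _
      (fun c => c.fst) (fun c => Category.comp_id _) (fun c => ?_) (fun c m h₁ _ => ?_))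
    · apply (cancel_mono t.left).1
      rw [Category.assoc, ← hfac]
      exact c.condition
    · simpa using h₁
  refine ⟨Over.isoMk hpb.isoPullback ?_, ?_⟩
  · change hpb.isoPullback.hom ≫ pullback.fst _ _ ≫ X.hom = X.hom
    rw [← Category.assoc, hpb.isoPullback_hom_fst, Category.id_comp]
  · ext : 1
    change hpb.isoPullback.hom ≫ pullback.fst _ _ = 𝟙 X.left
    exact hpb.isoPullback_hom_fst

/-- **The fibre of the constant map at `t` over a point `o ≠ t` is empty.** [cite: Hartshorne1977, II.3] -/
theorem isEmpty_fiberOver_const (X : SchemeOver ℂ) {t o : AlgPoints C ℂ} (h : o.pt ≠ t.pt) :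
    IsEmpty ↥(fiberOver (toUnit X ≫ (AffineLineProduct.specOverSelfIso ℂ).inv ≫ t) o).left := by
  refine ⟨fun z => h ?_⟩
  have hc := congrArg (fun k => k.base z)
    (pullback.condition (f := (toUnit X ≫ (AffineLineProduct.specOverSelfIso ℂ).inv ≫ t).left) (g := o.left))
  simp only [Scheme.Hom.comp_base, TopCat.comp_app] at hc
  have h1 : (toUnit X ≫ (AffineLineProduct.specOverSelfIso ℂ).inv ≫ t).left.base
        (pullback.fst (toUnit X ≫ (AffineLineProduct.specOverSelfIso ℂ).inv ≫ t).left o.left |>.base z) =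
      t.left.base ((toUnit X ≫ (AffineLineProduct.specOverSelfIso ℂ).inv).left.base
        (pullback.fst (toUnit X ≫ (AffineLineProduct.specOverSelfIso ℂ).inv ≫ t).left o.left |>.base z)) := by
    simp only [Over.comp_left, Scheme.Hom.comp_base, TopCat.comp_app]
  rw [pt_eq_base o (pullback.snd (toUnit X ≫ (AffineLineProduct.specOverSelfIso ℂ).inv ≫ t).left o.left |>.base z),
    ← hc, h1, ← pt_eq_base t]

end ConstantMap

/-- **Without surjectivity of `f` (`hf`) the crux is equivalent to Conj. 11.2.17.** (→) the
constant map `X ⟶ ℙ¹` at `t` and a second point `o ≠ t` of the infinite `ℙ¹(ℂ)`: the fibre over `o`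
is EMPTY, so `ι = PEmpty` covers it and every piece hypothesis is vacuous, while the fibre over `t`
is `X`; transport along `X ≅ X_t` (`stub_absoluteOfIso`). (←) as before.
[cite: CharlesSchnell2014Notes, §11.2.5 Conj. 11.2.17] -/
theorem boundaryAbsoluteness_without_surjective_iff :
    (∀ (N p : ℕ) (𝒳 C : SchemeOver ℂ) (f : 𝒳 ⟶ C) (o : AlgPoints C ℂ),
        IsSmoothProjective N 𝒳 → IsSmoothProjective 1 C →
        ∀ (ι : Type) [Finite ι] (m : ι → ℕ) (Y : ι → SchemeOver ℂ) (g : ∀ i, Y i ⟶ fiberOver f o),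
          (∀ i, IsSmoothProjective (m i) (Y i)) →
          (∀ x : ↥(fiberOver f o).left, ∃ (i : ι) (y : ↥(Y i).left), (g i).left.base y = x) →
          ∀ ξ : complexBetti 𝒳 (2 * p), IsRationalClass ξ → IsOfHodgeType N 𝒳 (2 * p) p p ξ →
            (∀ i, IsAbsoluteHodgeClass (m i) (Y i) p
              (complexBetti.map (g i ≫ fiberι f o) (2 * p) ξ)) →
            ∀ (t : AlgPoints C ℂ) (n : ℕ), IsSmoothProjective n (fiberOver f t) →
              IsAbsoluteHodgeClass n (fiberOver f t) p (complexBetti.map (fiberι f t) (2 * p) ξ)) ↔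
      (∀ ⦃n : ℕ⦄ ⦃X : SchemeOver ℂ⦄, IsSmoothProjective n X →
        ∀ (p : ℕ) (c : complexBetti X (2 * p)), IsRationalClass c →
          IsOfHodgeType n X (2 * p) p p c → IsAbsoluteHodgeClass n X p c) := by
  constructor
  · intro h n X hX p c hc hpp
    have hC : IsSmoothProjective 1 (projectiveSpace 1 ℂ) := isSmoothProjective_projectiveSpace_holds ℂ 1
    haveI : Infinite (ComplexPoints (projectiveSpace 1 ℂ)) :=
      HodgeBeyondAnchors.infinite_complexPoints_projectiveSpace_one
    obtain ⟨t⟩ : Nonempty (ComplexPoints (projectiveSpace 1 ℂ)) := inferInstance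
    obtain ⟨o, hot⟩ := exists_ne t
    have hpt : o.pt ≠ t.pt := fun h' => hot (ComplexPoints.ext_of_pt_eq h')
    obtain ⟨e, he⟩ := exists_iso_fiberOver_const X t
    haveI := isEmpty_fiberOver_const X hpt
    have ht : IsSmoothProjective n (fiberOver (toUnit X ≫ (AffineLineProduct.specOverSelfIso ℂ).inv ≫ t) t) :=
      hX.of_iso e
    have key := h n p X (projectiveSpace 1 ℂ) (toUnit X ≫ (AffineLineProduct.specOverSelfIso ℂ).inv ≫ t) o hX hC
      PEmpty (fun i => i.elim) (fun i => i.elim) (fun i => i.elim) (fun i => i.elim)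
      (fun x => isEmptyElim x) c hc hpp (fun i => i.elim) t n ht
    have hback := stub_absoluteOfIso e ht hX p _ key
    rwa [← complexBetti_map_comp_apply, he, complexBetti.map_id] at hback
  · intro hHA N p 𝒳 C f o h𝒳 _ ι _ m Y g _ _ ξ hξr hξh _ t n ht
    exact hHA ht p _ (hξr.pullback (AlgPoints.mapContinuous (L := ℂ) (fiberι f t)))
      (hξh.map_of_isSmoothProjective ht h𝒳 (fiberι f t))

/-! ### `ht`: the conclusion's fibre hypothesis cannot be deleted -/

/-- A scheme isomorphic (over `ℂ`) to the point has exactly one complex point. [folklore] -/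
theorem subsingleton_complexPoints_of_iso_unit {Z : SchemeOver ℂ} (e : 𝟙_ (SchemeOver ℂ) ≅ Z) :
    Subsingleton (ComplexPoints Z) ∧ Nonempty (ComplexPoints Z) := by
  refine ⟨⟨fun P Q => ?_⟩, ⟨toUnit _ ≫ e.hom⟩⟩
  have h : P ≫ e.inv = Q ≫ e.inv := toUnit_unique _ _
  simpa using congrArg (· ≫ e.hom) h

/-- **No Hodge model of positive dimension on a one-point scheme**: its carrier would be one point
`m₀` (homeomorphic to `Z(ℂ)`), and the chart at `m₀` would have the open singleton `{chart m₀}` as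
target in the model space, a complex normed space of dimension `n ≥ 1`, which has no isolated point.
[cite: SerreGAGA1956, §2] -/
theorem false_of_hodgeModel_of_subsingleton {Z : SchemeOver ℂ} [Subsingleton (ComplexPoints Z)]
    [hne : Nonempty (ComplexPoints Z)] {n : ℕ} (hn : 1 ≤ n) (A : HodgeModel n Z) : False := by
  have hφ := A.isAnalytification
  haveI : Subsingleton A.carrier := hφ.isHomeomorph.injective.subsingleton
  obtain ⟨P⟩ := hne
  obtain ⟨m₀, -⟩ := hφ.isHomeomorph.surjective P
  haveI : Nontrivial A.model :=
    Module.nontrivial_of_finrank_pos (R := ℂ) (by rw [hφ.finrank_eq]; omega)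
  set c := chartAt A.model m₀
  have htgt : c.target = {c m₀} := by
    ext y
    simp only [Set.mem_singleton_iff]
    constructor
    · intro hy
      have h1 : c (c.symm y) = y := c.right_inv hy
      rw [Subsingleton.elim (c.symm y) m₀] at h1
      exact h1.symm
    · rintro rfl
      exact c.map_source (mem_chart_source _ m₀)
  have hopen : IsOpen ({c m₀} : Set A.model) := htgt ▸ c.open_target
  exact (Module.punctured_nhds_neBot ℂ A.model (c m₀)).ne
    ((isOpen_singleton_iff_punctured_nhds (c m₀)).1 hopen)

/-- **The fibre hypothesis `ht : IsSmoothProjective n (fiberOver f t)` is load-bearing: without it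
the crux is FALSE.** Witness with every hypothesis discharged in the tree: the constant family of
the point `pt × ℙ¹ ⟶ ℙ¹` (`exists_constFamily` at `X = 𝟙_`), `p = 1`, `ξ = pr₁^* 0`, one piece
`Y = 𝟙_` glued onto `X_t ≅ pt` by the slice isomorphism (it covers), absolute Hodge on the piece
(`isAbsoluteHodgeClass_unit`, `H²(pt) = 0`); the deleted clause at `n = 1` yields, through the
Hodge-type conjunct of `IsAbsoluteHodgeClass 1 X_t 1 _`, a `HodgeModel 1 X_t` of the one-point
scheme `X_t` — impossible (`false_of_hodgeModel_of_subsingleton`).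
[cite: CharlesSchnell2014Notes, Def. 11.2.3] -/
theorem boundaryAbsoluteness_false_without_fibreHyp :
    ¬ (∀ (N p : ℕ) (𝒳 C : SchemeOver ℂ) (f : 𝒳 ⟶ C) (o : AlgPoints C ℂ),
        IsSmoothProjective N 𝒳 → IsSmoothProjective 1 C → Function.Surjective f.left.base →
        ∀ (ι : Type) [Finite ι] (m : ι → ℕ) (Y : ι → SchemeOver ℂ) (g : ∀ i, Y i ⟶ fiberOver f o),
          (∀ i, IsSmoothProjective (m i) (Y i)) →
          (∀ x : ↥(fiberOver f o).left, ∃ (i : ι) (y : ↥(Y i).left), (g i).left.base y = x) →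
          ∀ ξ : complexBetti 𝒳 (2 * p), IsRationalClass ξ → IsOfHodgeType N 𝒳 (2 * p) p p ξ →
            (∀ i, IsAbsoluteHodgeClass (m i) (Y i) p
              (complexBetti.map (g i ≫ fiberι f o) (2 * p) ξ)) →
            ∀ (t : AlgPoints C ℂ) (n : ℕ),
              IsAbsoluteHodgeClass n (fiberOver f t) p (complexBetti.map (fiberι f t) (2 * p) ξ)) := by
  intro h
  have hU : IsSmoothProjective 0 (𝟙_ (SchemeOver ℂ)) := isSmoothProjective_unit_holds ℂ
  obtain ⟨𝒳, C, f, t, ξ, e, h𝒳, hC, hf, hξr, hξh, -, hcov, -⟩ :=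
    exists_constFamily hU 1 (0 : complexBetti (𝟙_ (SchemeOver ℂ)) (2 * 1))
  have key := h (0 + 1) 1 𝒳 C f t h𝒳 hC hf Unit (fun _ => 0) (fun _ => 𝟙_ (SchemeOver ℂ))
    (fun _ => e.hom) (fun _ => hU) (fun x => ?_) ξ (hξr IsRationalClass.zero)
    (hξh (isOfHodgeType_zero_of_isSmoothProjective nonempty_hodgeModel_holds hU _ _ _))
    (fun _ => isAbsoluteHodgeClass_unit le_rfl _) t 1
  · obtain ⟨A, -⟩ := key.2.1
    obtain ⟨hs, hne⟩ := subsingleton_complexPoints_of_iso_unit e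
    exact false_of_hodgeModel_of_subsingleton le_rfl A
  · obtain ⟨y, hy⟩ := hcov x
    exact ⟨(), y, hy⟩

end Summit.HodgeConjecture.HodgeConjecture.Theorems.BoundaryAbsoluteness.Negative.LoadBearing

end
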